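import Summits.PneNP.PneNP.Theorems.ExpanderLinearGeneratorsColumnTwoBasic

/-!
# PneNP / ExpanderLinearGenerators — column weight two: a dense expanding core under WEAK local
expansion (Krivelevich's extraction, slack-parametrised)

Route `PneNP/ExpanderLinearGenerators` (column-weight-two routing machinery), support for crux
stmt-PneNP-11426 (`ExpandingXorDepthFregeLB`, route `PneNP/MatroidTseitin`) at column weight `≤ 2`.
`…ColumnTwoExtract`/`…ColumnTwoCore` run Krivelevich's extraction with thresholds near `0.498`,
which needs LOSSLESS local sparsity (`8 e(W) ≤ Σ_W |S ·|`). Under WEAK boundary expansion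
(`|W| ≤ q |∂W|` for `|W| ≤ r`) small sets are only slightly sparse: `2q e(W) + |W| ≤ q Σ_W |S ·|`.
This file redoes the extraction with the thresholds
`θ_i = (4M(i+1) - (2i+1)) / (8M(i+1))`, `M = ℓ q` (all in `(1/2 - 1/(4M), 1/2]`, gaps
`1/(8M(i+1)(i+2))`), in cross-multiplied form `4M(i+1) Σ ≤ 8M(i+1) e + (2i+1) Σ`:

* `exists_weak_core` — in a boundaryless `C₀` with `|C₀| > r`, weakly locally sparse at scale `r`
  with scopes of size in `[1, ℓ]`, some `U ⊆ C₀` with `|U| > r` and level `i` (`2^i ≤ |C₀|`) has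
  the touching and stopping properties for these thresholds;
* `weak_sum_le_cut`, `weak_card_le_nbr` — consequently every `W ⊆ U` with `2|W| ≤ |U|` has
  `Σ_W |S ·| ≤ 8M(i+1)(i+2) |cut U W|` and `|W| ≤ 8Mℓ(i+1)(i+2) |nbr U W|`: the core is a GLOBAL
  vertex expander of rate `Ω(1/(ℓ² q log²))` — the input of `exists_clique_minor_of_expander`.

References: M. Krivelevich, *Finding and using expanders in locally sparse graphs*, SIAM J.
Discrete Math. 32 (2018) 611–623 (arXiv:1704.00465), Theorem 1 and §2.
-/

namespace Summit.PneNP.PneNP.Theorems.ColumnTwo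

set_option linter.dupNamespace false -- `Summit.PneNP.PneNP.…`: summit = sub-problem (D-0017)

open Finset Literature.Computability.MetaComplexity

variable {ι : Type*} [Fintype ι] [DecidableEq ι] {S : ι → Finset ℕ}

/-- **Krivelevich's extraction under weak local sparsity.** In a scope family of column weight
`≤ 2` with scopes of size `≤ ℓ`, `ℓ ≥ 1`, let `C₀` be a boundaryless row set with `|C₀| > r`,
weakly locally sparse at scale `r`: `2q e(W) + |W| ≤ q Σ_{k∈W} |S k|` for
`W ⊆ C₀`, `|W| ≤ r`. Put `M = ℓ q`. Then some `U ⊆ C₀` with `|U| > r` and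
some level `i` with `2^i ≤ |C₀|` satisfy: (touching) `4M(i+1) Σ_W ≤ 8M(i+1) (e(U) - e(U \ W)) + (2i+1) Σ_W` for all
`W ⊆ U`; (stopping) `8M(i+2) e(W) + (2i+3) Σ_W < 4M(i+2) Σ_W` for all `W ⊆ U` with `r < |W|`,
`2|W| ≤ |U|`. [cite: Krivelevich2018LocallySparse, Theorem 1] -/
theorem exists_weak_core (hcw : ∀ v, coverDegree S Finset.univ v ≤ 2) {C₀ : Finset ι} {r ℓ q : ℕ}
    (hℓ : ∀ k, (S k).card ≤ ℓ) (hℓ1 : 1 ≤ ℓ)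
    (hcl : boundary S C₀ = ∅) (hr : r < C₀.card)
    (hLS : ∀ W ⊆ C₀, W.card ≤ r → 2 * q * eIn S W + W.card ≤ q * ∑ k ∈ W, (S k).card) :
    ∃ U ⊆ C₀, ∃ i : ℕ, 2 ^ i ≤ C₀.card ∧ r < U.card ∧
      (∀ W ⊆ U, 4 * (ℓ * q) * (i + 1) * ∑ k ∈ W, (S k).card ≤
        8 * (ℓ * q) * (i + 1) * (eIn S U - eIn S (U \ W)) + (2 * i + 1) * ∑ k ∈ W, (S k).card) ∧
      (∀ W ⊆ U, r < W.card → 2 * W.card ≤ U.card →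
        8 * (ℓ * q) * (i + 2) * eIn S W + (2 * i + 3) * ∑ k ∈ W, (S k).card <
          4 * (ℓ * q) * (i + 2) * ∑ k ∈ W, (S k).card) := by
  classical
  set M := ℓ * q with hM
  -- levels
  set P : ℕ → Prop := fun i => ∃ T ⊆ C₀, r < T.card ∧ 2 ^ i * T.card ≤ C₀.card ∧
    4 * M * (i + 1) * ∑ k ∈ T, (S k).card ≤
      8 * M * (i + 1) * eIn S T + (2 * i + 1) * ∑ k ∈ T, (S k).card with hP
  have hP0 : P 0 := by
    refine ⟨C₀, Finset.Subset.refl _, hr, by simp, ?_⟩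
    have h := sum_card_eq hcw C₀
    rw [hcl, Finset.card_empty, zero_add] at h
    rw [h]; ring_nf; omega
  have hPbound : ∀ i, P i → i < C₀.card := by
    rintro i ⟨T, -, hT, hTi, -⟩
    have h1 : 1 ≤ T.card := by omega
    have h2 : 2 ^ i ≤ C₀.card := le_trans (by simpa using Nat.mul_le_mul_left (2 ^ i) h1) hTi
    exact lt_of_lt_of_le (Nat.lt_two_pow_self) h2
  obtain ⟨i, hi, himax⟩ := Finset.exists_max_image ((Finset.range C₀.card).filter P) id
    ⟨0, Finset.mem_filter.2 ⟨Finset.mem_range.2 (by omega), hP0⟩⟩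
  have hPi : P i := (Finset.mem_filter.1 hi).2
  have hnot : ¬ P (i + 1) := fun h => by
    have := himax (i + 1) (Finset.mem_filter.2 ⟨Finset.mem_range.2 (hPbound _ h), h⟩)
    simp at this
  obtain ⟨T, hTC, hrT, hTi, hTdense⟩ := hPi
  -- the card-minimal dense nonempty subset of `T`
  set D := T.powerset.filter fun U => U.Nonempty ∧
    4 * M * (i + 1) * ∑ k ∈ U, (S k).card ≤
      8 * M * (i + 1) * eIn S U + (2 * i + 1) * ∑ k ∈ U, (S k).card with hD
  have hTD : T ∈ D := Finset.mem_filter.2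
    ⟨Finset.mem_powerset.2 (Finset.Subset.refl _), Finset.card_pos.1 (by omega), hTdense⟩
  obtain ⟨U, hUD, hUmin⟩ := Finset.exists_min_image D Finset.card ⟨T, hTD⟩
  obtain ⟨hUT, hUne, hUdense⟩ : U ⊆ T ∧ U.Nonempty ∧
      4 * M * (i + 1) * ∑ k ∈ U, (S k).card ≤
        8 * M * (i + 1) * eIn S U + (2 * i + 1) * ∑ k ∈ U, (S k).card := by
    have := Finset.mem_filter.1 hUD
    exact ⟨Finset.mem_powerset.1 this.1, this.2.1, this.2.2⟩
  have hUC : U ⊆ C₀ := hUT.trans hTC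
  refine ⟨U, hUC, i, ?_, ?_, ?_, ?_⟩
  · have h1 : 1 ≤ T.card := by omega
    exact le_trans (by simpa using Nat.mul_le_mul_left (2 ^ i) h1) hTi
  · -- `|U| > r` by weak local sparsity
    by_contra hle
    push Not at hle
    have h1 := hLS U hUC hle
    have hsum : ∑ k ∈ U, (S k).card ≤ ℓ * U.card := by
      calc ∑ k ∈ U, (S k).card ≤ ∑ k ∈ U, ℓ := Finset.sum_le_sum fun k _ => hℓ k
        _ = ℓ * U.card := by rw [Finset.sum_const, smul_eq_mul, mul_comm]
    have hUpos : 1 ≤ U.card := Finset.card_pos.2 hUne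
    -- divide the density inequality by `i + 1`
    have h2 : 4 * M * ∑ k ∈ U, (S k).card ≤ 8 * M * eIn S U + 2 * ∑ k ∈ U, (S k).card := by
      have h3 : (i + 1) * (4 * M * ∑ k ∈ U, (S k).card) ≤
          (i + 1) * (8 * M * eIn S U + 2 * ∑ k ∈ U, (S k).card) := by
        have : (2 * i + 1) * ∑ k ∈ U, (S k).card ≤ (2 * (i + 1)) * ∑ k ∈ U, (S k).card :=
          Nat.mul_le_mul_right _ (by omega)
        nlinarith
      exact Nat.le_of_mul_le_mul_left h3 (by omega)
    -- `8 M e = 4 ℓ (2 q e) ≤ 4 ℓ (q Σ - |U|)`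
    have h4 : 8 * M * eIn S U + 4 * ℓ * U.card ≤ 4 * M * ∑ k ∈ U, (S k).card := by
      have := Nat.mul_le_mul_left (4 * ℓ) h1
      have e : 4 * ℓ * (2 * q * eIn S U + U.card) = 8 * M * eIn S U + 4 * ℓ * U.card := by
        rw [hM]; ring
      have e' : 4 * ℓ * (q * ∑ k ∈ U, (S k).card) = 4 * M * ∑ k ∈ U, (S k).card := by
        rw [hM]; ring
      rw [e, e'] at this; exact this
    nlinarith
  · -- touching
    intro W hWU
    rcases W.eq_empty_or_nonempty with rfl | hWne
    · simp
    by_cases hWeq : W = U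
    · subst hWeq
      simpa only [Finset.sdiff_self, eIn_empty, Nat.sub_zero] using hUdense
    have hne : (U \ W).Nonempty := Finset.sdiff_nonempty.2 fun h => hWeq (subset_antisymm hWU h)
    have hlt : (U \ W).card < U.card := by
      have := Finset.card_sdiff_add_card_eq_card hWU
      have := Finset.card_pos.2 hWne
      omega
    have hnotD : U \ W ∉ D := fun h => absurd (hUmin _ h) (by omega)
    have hfail : 8 * M * (i + 1) * eIn S (U \ W) + (2 * i + 1) * ∑ k ∈ U \ W, (S k).card <
        4 * M * (i + 1) * ∑ k ∈ U \ W, (S k).card := by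
      by_contra hge
      push Not at hge
      exact hnotD (Finset.mem_filter.2
        ⟨Finset.mem_powerset.2 (Finset.sdiff_subset.trans hUT), hne, hge⟩)
    have hsum : ∑ k ∈ U, (S k).card = ∑ k ∈ W, (S k).card + ∑ k ∈ U \ W, (S k).card := by
      rw [← Finset.sum_union Finset.disjoint_sdiff, Finset.union_sdiff_of_subset hWU]
    have hmono : eIn S (U \ W) ≤ eIn S U := eIn_mono Finset.sdiff_subset
    rw [hsum] at hUdense
    zify [hmono] at hUdense hfail ⊢
    nlinarith
  · -- stopping
    intro W hWU hrW h2W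
    by_contra hge
    push Not at hge
    refine hnot ⟨W, hWU.trans hUC, hrW, ?_, ?_⟩
    · calc 2 ^ (i + 1) * W.card = 2 ^ i * (2 * W.card) := by ring
        _ ≤ 2 ^ i * U.card := Nat.mul_le_mul_left _ h2W
        _ ≤ 2 ^ i * T.card := Nat.mul_le_mul_left _ (Finset.card_le_card hUT)
        _ ≤ C₀.card := hTi
    · have e1 : 4 * M * (i + 1 + 1) = 4 * M * (i + 2) := by ring
      have e2 : 8 * M * (i + 1 + 1) = 8 * M * (i + 2) := by ring
      have e3 : 2 * (i + 1) + 1 = 2 * i + 3 := by ring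
      rw [e1, e2, e3]
      exact hge

/-! ### Expansion inside the weak core -/

section Core

variable (hcw : ∀ v, coverDegree S Finset.univ v ≤ 2) {C₀ U : Finset ι} {r ℓ q i : ℕ}
  (hℓ : ∀ k, (S k).card ≤ ℓ)
  (hLS : ∀ W ⊆ C₀, W.card ≤ r → 2 * q * eIn S W + W.card ≤ q * ∑ k ∈ W, (S k).card)
  (hUC : U ⊆ C₀)
  (htouch : ∀ W ⊆ U, 4 * (ℓ * q) * (i + 1) * ∑ k ∈ W, (S k).card ≤
    8 * (ℓ * q) * (i + 1) * (eIn S U - eIn S (U \ W)) + (2 * i + 1) * ∑ k ∈ W, (S k).card)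
  (hstop : ∀ W ⊆ U, r < W.card → 2 * W.card ≤ U.card →
    8 * (ℓ * q) * (i + 2) * eIn S W + (2 * i + 3) * ∑ k ∈ W, (S k).card <
      4 * (ℓ * q) * (i + 2) * ∑ k ∈ W, (S k).card)
include hcw htouch

/-- The touching property in terms of the cut. [folklore] -/
theorem weak_touch_cut {W : Finset ι} (hW : W ⊆ U) :
    4 * (ℓ * q) * (i + 1) * ∑ k ∈ W, (S k).card ≤
      8 * (ℓ * q) * (i + 1) * (eIn S W + (cut S U W).card) + (2 * i + 1) * ∑ k ∈ W, (S k).card := by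
  have h := htouch W hW
  have h2 := eIn_eq_add hcw hW
  rwa [show eIn S U - eIn S (U \ W) = eIn S W + (cut S U W).card by omega] at h

include hℓ hLS hUC in
/-- **Small sets have large cuts**: `W ⊆ U`, `|W| ≤ r` ⟹ `Σ_{k∈W} |S k| ≤ 4 ℓ q |cut U W|`.
[folklore] -/
theorem weak_cut_small {W : Finset ι} (hW : W ⊆ U) (hWr : W.card ≤ r) :
    ∑ k ∈ W, (S k).card ≤ 4 * (ℓ * q) * (cut S U W).card := by
  have h1 := weak_touch_cut hcw htouch hW
  have h2 := hLS W (hW.trans hUC) hWr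
  have hsum : ∑ k ∈ W, (S k).card ≤ ℓ * W.card := by
    calc ∑ k ∈ W, (S k).card ≤ ∑ k ∈ W, ℓ := Finset.sum_le_sum fun k _ => hℓ k
      _ = ℓ * W.card := by rw [Finset.sum_const, smul_eq_mul, mul_comm]
  -- divide the touching inequality by `i + 1`
  have h3 : 4 * (ℓ * q) * ∑ k ∈ W, (S k).card ≤
      8 * (ℓ * q) * (eIn S W + (cut S U W).card) + 2 * ∑ k ∈ W, (S k).card := by
    have h4 : (i + 1) * (4 * (ℓ * q) * ∑ k ∈ W, (S k).card) ≤
        (i + 1) * (8 * (ℓ * q) * (eIn S W + (cut S U W).card) + 2 * ∑ k ∈ W, (S k).card) := by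
      have : (2 * i + 1) * ∑ k ∈ W, (S k).card ≤ (2 * (i + 1)) * ∑ k ∈ W, (S k).card :=
        Nat.mul_le_mul_right _ (by omega)
      nlinarith
    exact Nat.le_of_mul_le_mul_left h4 (by omega)
  -- `8 ℓ q e + 4 ℓ |W| ≤ 4 ℓ q Σ`
  have h5 : 8 * (ℓ * q) * eIn S W + 4 * ℓ * W.card ≤ 4 * (ℓ * q) * ∑ k ∈ W, (S k).card := by
    have := Nat.mul_le_mul_left (4 * ℓ) h2
    have e : 4 * ℓ * (2 * q * eIn S W + W.card) = 8 * (ℓ * q) * eIn S W + 4 * ℓ * W.card := by ring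
    have e' : 4 * ℓ * (q * ∑ k ∈ W, (S k).card) = 4 * (ℓ * q) * ∑ k ∈ W, (S k).card := by ring
    rw [e, e'] at this; exact this
  nlinarith

include hstop in
/-- **Large sets have cuts at rate `1/(8 ℓ q (i+1)(i+2))`**: `W ⊆ U`, `r < |W|`, `2|W| ≤ |U|` ⟹
`Σ_{k∈W} |S k| < 8 ℓ q (i+1)(i+2) |cut U W|`. [folklore] -/
theorem weak_cut_big {W : Finset ι} (hW : W ⊆ U) (hrW : r < W.card) (h2W : 2 * W.card ≤ U.card) :
    ∑ k ∈ W, (S k).card < 8 * (ℓ * q) * (i + 1) * (i + 2) * (cut S U W).card := by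
  have ht := weak_touch_cut hcw htouch hW
  have hs := hstop W hW hrW h2W
  have ht' := Nat.mul_le_mul_left (i + 2) ht
  have hs' := Nat.mul_lt_mul_of_pos_left hs (show 0 < i + 1 by omega)
  generalize ℓ * q = M at ht' hs' ⊢
  generalize ∑ k ∈ W, (S k).card = A at ht' hs' ⊢
  generalize eIn S W = E at ht' hs'
  generalize (cut S U W).card = C at ht' ⊢
  have key : (i + 2) * (4 * M * (i + 1) * A) + ((i + 1) * (8 * M * (i + 2) * E + (2 * i + 3) * A)) <
      (i + 2) * (8 * M * (i + 1) * (E + C) + (2 * i + 1) * A) + (i + 1) * (4 * M * (i + 2) * A) :=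
    Nat.add_lt_add_of_le_of_lt ht' hs'
  nlinarith

include hℓ hLS hUC hstop in
/-- **Cuts at all scales**: `W ⊆ U`, `2|W| ≤ |U|` ⟹ `Σ_{k ∈ W} |S k| ≤ 8 ℓ q (i+1)(i+2) |cut U W|`.
[folklore] -/
theorem weak_sum_le_cut {W : Finset ι} (hW : W ⊆ U) (h2W : 2 * W.card ≤ U.card) :
    ∑ k ∈ W, (S k).card ≤ 8 * (ℓ * q) * (i + 1) * (i + 2) * (cut S U W).card := by
  by_cases hWr : W.card ≤ r
  · have h := weak_cut_small hcw hℓ hLS hUC htouch hW hWr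
    have h1 : 4 * (ℓ * q) ≤ 8 * (ℓ * q) * (i + 1) * (i + 2) := by
      have : 1 ≤ (i + 1) * (i + 2) := Nat.one_le_iff_ne_zero.2 (by positivity)
      calc 4 * (ℓ * q) ≤ 8 * (ℓ * q) * 1 := by omega
        _ ≤ 8 * (ℓ * q) * ((i + 1) * (i + 2)) := Nat.mul_le_mul_left _ this
        _ = _ := by ring
    exact h.trans (Nat.mul_le_mul_right _ h1)
  · exact (weak_cut_big hcw htouch hstop hW (by omega) h2W).le

include hℓ hLS hUC hstop in
/-- **Vertex expansion at all scales** (the weak core is a `1/(8 ℓ² q (i+1)(i+2))`-expander):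
`W ⊆ U`, `2|W| ≤ |U|`, rows of positive degree ⟹ `|W| ≤ 8 ℓ² q (i+1)(i+2) |nbr U W|`.
[folklore] -/
theorem weak_card_le_nbr (hdeg : ∀ k ∈ U, 0 < (S k).card) {W : Finset ι} (hW : W ⊆ U)
    (h2W : 2 * W.card ≤ U.card) :
    W.card ≤ 8 * (ℓ * q) * (i + 1) * (i + 2) * ℓ * (nbr S U W).card := by
  have h1 := weak_sum_le_cut hcw hℓ hLS hUC htouch hstop hW h2W
  have h2 := card_cut_le hℓ U W
  have h3 : W.card ≤ ∑ k ∈ W, (S k).card := by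
    calc W.card = ∑ k ∈ W, 1 := by simp
      _ ≤ _ := Finset.sum_le_sum fun k hk => hdeg k (hW hk)
  calc W.card ≤ ∑ k ∈ W, (S k).card := h3
    _ ≤ 8 * (ℓ * q) * (i + 1) * (i + 2) * (cut S U W).card := h1
    _ ≤ 8 * (ℓ * q) * (i + 1) * (i + 2) * (ℓ * (nbr S U W).card) := Nat.mul_le_mul_left _ h2
    _ = _ := by ring

end Core

end Summit.PneNP.PneNP.Theorems.ColumnTwo
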